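import Summits.CriticalPhenomena.SAWScalingLimit.Theses.SAWDefectDecoherence
import Summits.CriticalPhenomena.SAWScalingLimit.Theses.SAWDevelopingMap
import Summits.CriticalPhenomena.SAWScalingLimit.Theorems.BoundaryClosureR.Negative.NormaliserPin
import Summits.CriticalPhenomena.SAWScalingLimit.Theorems.BoundaryClosureR.Negative.RootPin

/-!
# Disproof of `HexObservableLimitR` (stmt-CriticalPhenomena-14003) — the standing adversary's work file

INTERIM PUBLICATION (gate backlog): the thirteen `Theorems/HexObservableLimitR/Negative/*.lean` files named below are
checked together (rc 0, 0 sorry, standard axioms) in the seat folder and are being landed (p82891 RadiusPos, p83668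
NormaliserValue, p83750 Mirror, p83796 FloorEdges, the rest follow their parents); this file will be re-published
importing them.  Until then the pointers of §1–§3 are prose only; the statements are quoted verbatim in the seat's
evidence attachment `NegativeTable.md`.

Crux: `Summit.CriticalPhenomena.SAWScalingLimit.Theses.SAWDefectDecoherence.HexObservableLimitR`
(≡ `…Theses.SAWDevelopingMap.HexObservableLimit`, `Iff.rfl`: one item, two route decls; also the target of
SAWResidueField / SAWPhaseRetrieval / SAWWindingAlias) — Duminil-Copin–Smirnov 2012 Conjecture 2 on the hexagonal
lattice, `ψ`-averaged over bulk mid-edges, normalised at one boundary mid-edge `b_δ`, REPAIRED (rev 4) after the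
corridor witness: BOTH marked points are pinned (flat half-plane piece of `∂Ω` and exact half-lattice of `Λ_δ`
inside `ball (pt i) ρ`), `∃ c ≠ 0` universal.

## Findings (cycle 1, 2026-08-16; refuter-cdisprove-stmt-CriticalPhenomena-14003-0)

* (F1) NO KILL.  The statement is open-problem content (DCS Conj. 2, arXiv:1007.0575 p. 7, read) in a junk-clean
  frame: `D = MarkedDomain 2` is the honest interior of its Jordan curve; `ConformalEquiv` an honest biholomorphism
  (`Φ` unique up to `λ > 0`, `L` up to `2πiℤ`, so `L - L_b` and the density are canonical); the `finsum` is finite;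
  `F_δ(b_δ) ≠ 0` eventually (deterministic boundary winding).  Rows `v.1 1` are the horizontal zigzag rows of
  `hexCenter`; the pinned boundary mid-edges are the VERTICAL edges `{(x,0),(x-e₁,1)}` only (midpoints ON the row
  line), so there is no second lattice class at `a` or `b` to play against the universal `c` (my first attack —
  dead on inspection of `TriangularLattice.hexCenter`).
* (F2, §3) SYMMETRY ⇒ THE CONSTANT IS REAL (`ConstReal.lean`, PROVED: `const_real : Body c → conj c = c`).  The
  lattice mirror `τ : z ↦ -conj z` (`σ (fj j r) = fj (-j-2r-2) r`, rows kept; `Mirror.lean`) is a graph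
  automorphism negating windings of honeycomb paths without immediate returns (`MirrorWinding.lean`: the turning
  angle is `arg` of a quotient whose imaginary part is `cross/|·|²`, and consecutive honeycomb increments are never
  parallel — an integer identity in the coordinates `2re = j+r+1`, `(6/√3) im = 3r + j%2 + 1`), hence
  `F_{σΩ, σa}(σz) = conj F_{Ω,a}(z)` for a boundary root and a lattice edge (`MirrorSAW.lean`: bijection of
  `HexMidEdgeSAW` under `σ`, `winding_eq_winding_map`, conjugate weights), and the pinned instance has an admissible
  mirror image (`MirrorInstance.lean`: `HD` marked `(0,-r)`, uniformiser `τ ∘ Ψ_r ∘ τ` holomorphic by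
  `HasDerivAt.conj_conj`, logarithm `conj ∘ M_r ∘ τ`); testing the instance and its mirror against a `τ`-invariant
  real bump `h₀` (test functions `h₀/g` and its conjugated reflection) gives `ratio → c∫h₀` and
  `conj ∘ ratio → c∫h₀`, `∫h₀ > 0`, so `c = conj c`.  CONSISTENT with the conjecture (no kill): no SELF-mirror
  configuration exists (the fixed geodesic of an anticonformal involution of `Ω` would join `a` to `b`, both
  bottom-type), so only `c ∈ ℝ` follows — but the natural strengthening "`∃ c ∉ ℝ`" is now refuted
  (`not_body_of_conj_ne`), and provers must produce a real constant.
* (F3) PHASE BOOKKEEPING is consistent with the lattice windings: `W(a → b) = -π + K^{ccw}_{ab}` (discrete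
  Umlaufsatz), `F(b) = e^{5πi/8} e^{-(5/8)iK} Z_{ab}`, and the predicted branch of `(Φ')^{5/8}` continued INSIDE
  `Ω` flips by `e^{-5πi/4}` across the root on both sides; the same-`Λ`-two-normalisers consequence
  `F(b')/F(b) → (Φ'(b')/Φ'(b))^{5/8}` is the boundary two-point law with exponent `5/4` — consistent with
  Lawler–Schramm–Werner / Kennedy–Lawler (both normalisers lie on horizontal floors: one lattice class).
* (F4) COLLAR FREEDOM away from the two balls: dead-end (single-entrance) decorations are EXACTLY invisible (no SAW
  to another target passes a dead end; cf. `PeelEnd.lean`) and conformally invisible; thick / mesoscopic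
  decorations admit no exact identity and are heuristically `o(1)` (restriction + `δ²` boundary-touching cost per
  door × `δ⁻¹` doors); the row thresholds `m i δ` (floor height `im pt_i + o(1)`) are harmless by Schwarz
  reflection across the fixed flat piece.  ⇒ nothing refutable without genuine SAW scaling-limit content.
* (F5, §1) LOAD-BEARING HYPOTHESES — every deletion below is a CHECKED `¬`-theorem (landing as
  `Theorems/HexObservableLimitR/Negative/*.lean`; the two lattice pins were landed by the sibling seat on
  `BoundaryClosureR`, `Theorems/BoundaryClosureR/Negative/{RootPin,NormaliserPin}.lean`):
  | hypothesis deleted                         | verdict | witness / file |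
  |--------------------------------------------|---------|----------------|
  | exact half-lattice at the ROOT `pt 0`      | FALSE   | corridor at the root (`not_hexObservableLimit_without_rootPin`, sibling) |
  | exact half-lattice at the NORMALISER `pt 1`| FALSE   | dead-end corridor ending at `b_δ`, `F(b_δ) · x_c^{-n} ` (`…_without_normaliserPin`, sibling) |
  | `0 < ρ`                                    | FALSE   | `ρ = 0` voids both pins ⇒ old stmt-5420 (`RadiusPos.lean`) |
  | `δ·mid(a δ) → pt 0`                        | FALSE   | root marked at `1/4` vs `1/3`, `endgame` (`MarkedLimits.lean`) |
  | `δ·mid(b δ) → pt 1`                        | FALSE   | normaliser marked at `1/4` vs `1/3`, `k_q = ((1-q²)/q²)^{-5/8}` (`MarkedLimits.lean`) |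
  | `‖Φ‖ → ∞` at `pt 0` (pole at the root)     | FALSE   | bent uniformiser `Ψ/(1+Ψ)`: `(1+Ψ)^{-5/4} ≡ 1` impossible (`RootPole.lean`) |
  | `ContinuousOn L Ω` (branch of `log Φ'`)    | FALSE   | `L + 2πi·𝟙_{re<0}`: factor `e^{5πi/4} ≠ 1` (`LogBranch.lean`) |
  | `exp L = Φ'`, `L → L_b`                    | FALSE (obvious: `L := 0`, resp. `L_b` shifted) — not formalised |
  | `Φ → 0` at `pt 1`                          | REDUNDANT — PROVED `hexObservableLimitR_iff_without_normaliserValue` (`NormaliserValue.lean`: the boundary value at `b` exists and is real by `L → L_b` + convexity of `Ω ∩ ball` + continuity of `Φ⁻¹`; `Φ - μ` has the same `Φ'`) |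
  | `Nonempty (HexMidEdgeSAW …)`               | REDUNDANT given `Preconnected` + distinct boundary edges (sibling work file `Cruxes/BoundaryClosureR/Disproof.lean §3`) |
  | `tsupport ψ ⊆ Ω`, `HasCompactSupport ψ`    | needed for the integral to make sense; boundary-supported `ψ` would see the boundary-layer constant (Kennedy–Lawler) — remark only |
* (F6, §2) NON-VACUITY (`ConstUnique.lean`): the hypothesis list is SATISFIABLE — the fully pinned instance
  (`PinnedInstance.lean`: half-disc, body `Lam δ false`, floor edges `bEdge → 0`, `vEdge ⌊r/δ⌋ → r`, `ρ = 1/8`,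
  `Ψ_r` / `Φ_r`) meets every hypothesis, so the universal constant is UNIQUE (`const_unique`,
  `hexObservableLimitR_iff_existsUnique`): the crux cannot close by vacuity, and `Body c` fails for all but at most
  one `c`.  NOT claimed: `¬ Body 0` (a lower bound on `|⟨ψ,F_δ⟩/F_δ(b_δ)|` is SAW content).
* (F7) LITERATURE: no counterexample to Conj. 2 in print; Kennedy–Lawler lattice effects concern boundary classes,
  fixed here; searches degraded this session (searchd FTS down, OpenAlex/S2 429) — arXiv:1007.0575 read from the
  held text.  `ledger negatives`: only stmt-5420 (root-free form) on this decl family.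

Targets (`payload.targets` / stuck stubs): none registered (no lead, no PICKED line on this crux yet).

## HANDOFF for the next arming
Landed under `Negative/`: see the imports (once the gate merges them; all thirteen files rc 0 together, 2801
lines, axioms standard).  Nothing sorried.  Next regimes: (i) the general mirror transport `Body c → Body (conj c)`
for ARBITRARY configurations (needs measure-preservation of `τ` for general `ψ`; the instance route above avoids
it); (ii) the general same-numerator corollary `Body c → F_δ(b'_δ)/F_δ(b_δ) → e^{(5/8)(L_b' - L_b)}` over
`MarkedDomain 3` (a necessary boundary two-point law, testable by enumeration); (iii) if a lead picks a line, attack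
its stubs with the instance calculus of `PinnedInstance.lean` (any stub implying a frame WITHOUT one of the table's
hypotheses is false by the corresponding row).
-/

noncomputable section

open Set Filter Topology Complex
open Literature.Probability.RandomPlanarGeometry
open Literature.Probability.LatticeModels Literature.Probability.RandomPlanarGeometry.SAW
open Summit.CriticalPhenomena.SAWScalingLimit.Theses.SAWDefectDecoherence

namespace Summit.CriticalPhenomena.SAWScalingLimit.Cruxes.HexObservableLimitR.Disproof

open Summit.CriticalPhenomena.SAWScalingLimit.Theorems.BoundaryClosureR.Negative

/-! ## §0 The two route declarations are one statement -/

/-- The SAWDevelopingMap copy of the crux is the same proposition. [folklore] -/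
theorem developingMap_iff :
    Summit.CriticalPhenomena.SAWScalingLimit.Theses.SAWDevelopingMap.HexObservableLimit ↔ HexObservableLimitR :=
  Iff.rfl

/-! ## §1 Load-bearing hypotheses already in the tree (sibling seat, crux `BoundaryClosureR`) -/

/-- Rows 1–2 of the table: the root's lattice pin cannot be dropped. [folklore] -/
example := @not_hexObservableLimit_without_rootPin

/-- Rows 1–2 of the table: the normaliser's lattice pin cannot be dropped. [folklore] -/
example := @not_hexObservableLimit_without_normaliserPin

end Summit.CriticalPhenomena.SAWScalingLimit.Cruxes.HexObservableLimitR.Disproof
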